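import Summits.QuantumFields.YangMills.Theorems.PoincareLipschitzLatticeToContinuumCellLetters
import Summits.QuantumFields.YangMills.Theorems.PoincareLipschitzSamplingCells
import Mathlib.MeasureTheory.Function.L2Space
import HarnessLib

/-!
# `PoincareLipschitzBlowDownEnergyLscEps` — LINE 25 S2♭″ brick (Γ2-lsc-ε) «THE ε-FORM OF THE SUB-CUBE LOWER SEMICONTINUITY ROW»
# (crux `BlockLipschitzL` stmt-QuantumFields-23533 ∕ `HistoryTailL` stmt-QuantumFields-19936, LINE 25 `compactness_transfer`; helper
# `--supports stmt-QuantumFields-23533 --as helper`, count-neutral)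

Cell `ym3-torus` (YM ladder rung R3 = continuum SU(2) Yang–Mills on T³ — a RUNG, NOT the Clay problem: not d = 4, not infinite volume, not a
mass gap); width seat `ym3-torus-px5` (g8).  THEOREMS ONLY (0 `def`, 0 `sorry`, default heartbeats); registry ∕ skeleton texts untouched.

WHY.  The Γ-KNIT (px3 g8, `PoincareLipschitzLatticeToContinuumLimit.latticeToContinuumLimit_of`, SIGNATURE-0 2026-08-29 12:40Z) consumes the
sub-cube lower semicontinuity of the weak gradient limit in ε-FORM (its hypothesis `hlsc`): for every sub-cube `Q_t`, `0 < t ≤ 1`, and every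
`ε > 0`, EVENTUALLY IN `k`, `∫_{Q_t} Σ_μ ‖G_μ‖² ≤ R_k⁻¹ · Σ_{y ∈ Q_{⌈t R_k⌉}(z_k)} Σ_μ ‖δ_μ u_k(y)‖² + ε` — the LIMINF form.  ★w8 g8's (Γ2-W) FILE C
✓`PoincareLipschitzDyadicMeansWeakLimitSocket` carries the EVENTUAL-BOUND form («`∫_{Q_t}‖G‖² ≤ M` whenever eventually `∫_{Q_t}‖v_k‖² ≤ M`»,
the LIMSUP form).  This file derives the stronger ε-form DIRECTLY from the `L²(Q)`-pairings (no subsequence): test with `ψ := 𝟙_{Q_t} G_μ`,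
the pointwise `⟪G, v⟫ ≤ (‖G‖² + ‖v‖²)∕2` (so no square root and NO dependence on FILE C's olean) give `A − η ≤ ∫_{Q_t}⟪G_μ, v_{k,μ}⟫ ≤ (A + B_k)∕2`, i.e.
`A ≤ B_k + 2η` for all large `k`; then the cell count ✓`PoincareLipschitzLatticeToContinuumCellLetters.setIntegral_normSq_diffQuot_le` (px3 g8) turns
`B_k = ∫_{Q_t}‖v_{k,μ}‖²` into `R_k⁻¹ · Σ_{Q_{⌈tR_k⌉}(z_k)} ‖δ_μ u_k‖²`.

WHAT IS PROVED (ns `…Theorems.PoincareLipschitzBlowDownEnergyLscEps`; cube `Q = {x | ∀ i, |x i| < 1}`, `Q_t = {x | ∀ i, |x i| < t}` as in Γ1∕FILE C;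
lattice letters `Zd`, `box`, `unitVec` of lit ✓`B4Eq19LatticeOperators`).
* §1 ★`memLp_blowDown_absCube` — the blow-down `x ↦ g(⌊R x⌋)` of ANY lattice map `g` (no bound assumed) is in `L^p(Q_t)` (finitely many values
  on `Q_t`; px3 g8's ✓`…CellLetters.memLp_diffQuot` is the unit-map special case — the knit's `hlsc` carries no unit hypothesis, hence this letter).
  The floor-image box ✓`floorVec_mem_box`, ✓`volume_absCube_lt_top` and the cell count ✓`setIntegral_normSq_diffQuot_le` are IMPORTED from
  px3 g8's ✓`PoincareLipschitzLatticeToContinuumCellLetters` (no copies here).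
* §2 ★★★ `subcube_normSq_weakLimit_le_latticeEnergy_add` — THE ε-FORM, conclusion and binders = the Γ-KNIT's `hlsc` text (px3 g8 12:40Z) VERBATIM.
HONEST SCOPE.  Measure-theoretic bookkeeping over landed letters; (Γ2-IBP), (Γ5), S2♭″, S1″, `hImproveCoreFlat`, `BlockLipschitzL`, `HistoryTailL`
are NOT proved here.  YM₃ on T³ is rung R3, not Clay; the YM mass gap is NOT proved; no summit statement is proved here.

References: L. Simon, Theorems on Regularity and Singularity of Energy Minimizing Maps (1996) §2.9 (lower semicontinuity of the Dirichlet energy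
under weak convergence); R. Alicandro, M. Cicalese, Arch. Ration. Mech. Anal. 192 (2009) 501–536 [AlicandroCicalese2008] (§2, piecewise-constant
interpolation of lattice maps and `Γ-liminf`).
-/

set_option autoImplicit false

noncomputable section

open MeasureTheory Filter Topology
open scoped RealInnerProductSpace ENNReal BigOperators

namespace Summit.QuantumFields.YangMills.Theorems.PoincareLipschitzBlowDownEnergyLscEps

open Literature.MathematicalPhysics.QuantumFieldTheory.Balaban1983to89
open B4Eq19LatticeOperators (Zd box unitVec)
open Summit.QuantumFields.YangMills.Theorems.PoincareLipschitzSamplingCells (isOpen_absCube)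
open Summit.QuantumFields.YangMills.Theorems.PoincareLipschitzBlowDownCells (memLp_comp_floorVec_of_bound)
open Summit.QuantumFields.YangMills.Theorems.PoincareLipschitzLatticeToContinuumCellLetters (floorVec_mem_box volume_absCube_lt_top
  setIntegral_normSq_diffQuot_le)

/-! ## §1 Blow-downs on a sub-cube: finitely many values, `L^p`, and the cell count -/

/-- ★ **Every blow-down is in `L^p` of a sub-cube**: for ANY lattice map `g : ℤ³ → E`, `R > 0`, `t ≥ 0` and every `p`, `x ↦ g(⌊R x⌋)` is in
`L^p(Q_t)` — it takes finitely many values there. [folklore] -/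
theorem memLp_blowDown_absCube {E : Type*} [NormedAddCommGroup E] [MeasurableSpace E] [BorelSpace E] [SecondCountableTopology E]
    (g : Zd 3 → E) {R : ℝ} (t : ℝ) (hR : 0 < R) (p : ℝ≥0∞) :
    MemLp (fun x : EuclideanSpace ℝ (Fin 3) => g (fun i => ⌊R * x i⌋)) p
      (volume.restrict {x : EuclideanSpace ℝ (Fin 3) | ∀ i : Fin 3, |x i| < t}) := by
  classical
  -- truncate `g` off the finite floor image of `Q_t`
  have hbound : ∀ y, ‖(fun y => if y ∈ box (0 : Zd 3) ⌈t * R⌉ then g y else 0) y‖ ≤ ∑ y' ∈ box (0 : Zd 3) ⌈t * R⌉, ‖g y'‖ := by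
    intro y
    by_cases hy : y ∈ box (0 : Zd 3) ⌈t * R⌉
    · simp only [hy, if_true]
      exact Finset.single_le_sum (fun y' _ => norm_nonneg (g y')) hy
    · simp only [hy, if_false, norm_zero]
      exact Finset.sum_nonneg fun _ _ => norm_nonneg _
  have h' := memLp_comp_floorVec_of_bound (fun y => if y ∈ box (0 : Zd 3) ⌈t * R⌉ then g y else 0) R hbound
    (volume_absCube_lt_top t) p
  refine h'.ae_eq ?_
  filter_upwards [ae_restrict_mem (isOpen_absCube t).measurableSet] with x hx
  have hmem : (fun i => ⌊R * x i⌋ : Zd 3) ∈ box (0 : Zd 3) ⌈t * R⌉ := floorVec_mem_box hR hx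
  simp only [hmem, if_true]

/-! ## §2 The ε-form of the sub-cube lower semicontinuity row -/

/-- ★★★ **(Γ2-lsc-ε) THE ε-FORM** (the Γ-KNIT's `hlsc`, px3 g8 2026-08-29 12:40Z, VERBATIM).  Let `u_k : ℤ³ → ℝ⁴`, centres `z_k`, radii `R_k ≥ k+1`,
`φ` strictly increasing, and `G_μ ∈ L²(Q; ℝ⁴)` (`μ < 3`) such that for every direction `μ` and every `ψ ∈ L²(Q; ℝ⁴)` the pairings
`∫_Q ⟪ψ, v_{φ k, μ}⟫ → ∫_Q ⟪ψ, G_μ⟫`, where `v_{k,μ}(x) = R_k•(u_k((z_k+⌊R_k x⌋)+e_μ) − u_k(z_k+⌊R_k x⌋))` is the rescaled forward difference of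
the blow-down.  Then for `0 < t ≤ 1` and `ε > 0` there is `k₀` with, for all `k ≥ k₀`,
`∫_{Q_t} Σ_μ ‖G_μ‖² ≤ R_{φk}⁻¹ · Σ_{y ∈ Q_{⌈t R_{φk}⌉}(z_{φk})} Σ_μ ‖u_{φk}(y+e_μ) − u_{φk}(y)‖² + ε`.
Proof: `ψ := 𝟙_{Q_t} G_μ`, the pointwise `⟪G, v⟫ ≤ (‖G‖² + ‖v‖²)∕2` on `Q_t`, and §1's cell count. [folklore]
[cite: Simon1996, §2.9; AlicandroCicalese2008, §2] -/
theorem subcube_normSq_weakLimit_le_latticeEnergy_add :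
    ∀ (u : ℕ → Zd 3 → EuclideanSpace ℝ (Fin 4)) (z : ℕ → Zd 3) (R : ℕ → ℤ) (φ : ℕ → ℕ)
      (G : Fin 3 → EuclideanSpace ℝ (Fin 3) → EuclideanSpace ℝ (Fin 4)),
      StrictMono φ → (∀ k : ℕ, (k : ℝ) + 1 ≤ R k) →
      (∀ μ : Fin 3, MemLp (G μ) 2 (volume.restrict {x : EuclideanSpace ℝ (Fin 3) | ∀ i : Fin 3, |x i| < 1})) →
      (∀ (μ : Fin 3) (ψ : EuclideanSpace ℝ (Fin 3) → EuclideanSpace ℝ (Fin 4)),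
        MemLp ψ 2 (volume.restrict {x : EuclideanSpace ℝ (Fin 3) | ∀ i : Fin 3, |x i| < 1}) →
        Tendsto (fun k : ℕ => ∫ x in {x : EuclideanSpace ℝ (Fin 3) | ∀ i : Fin 3, |x i| < 1},
            ⟪ψ x, (R (φ k) : ℝ) • (u (φ k) ((z (φ k) + fun i => ⌊(R (φ k) : ℝ) * x i⌋) + unitVec μ)
                - u (φ k) (z (φ k) + fun i => ⌊(R (φ k) : ℝ) * x i⌋))⟫) atTop
          (𝓝 (∫ x in {x : EuclideanSpace ℝ (Fin 3) | ∀ i : Fin 3, |x i| < 1}, ⟪ψ x, G μ x⟫))) →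
      ∀ (t ε : ℝ), 0 < t → t ≤ 1 → 0 < ε → ∃ k₀ : ℕ, ∀ k : ℕ, k₀ ≤ k →
        ∫ x in {x : EuclideanSpace ℝ (Fin 3) | ∀ i : Fin 3, |x i| < t}, ∑ μ : Fin 3, ‖G μ x‖ ^ 2 ≤
          (R (φ k) : ℝ)⁻¹ * (∑ y ∈ box (z (φ k)) ⌈t * (R (φ k) : ℝ)⌉, ∑ μ : Fin 3, ‖(u (φ k)) (y + unitVec μ) - (u (φ k)) y‖ ^ 2) + ε := by
  intro u z R φ G _hφ hR hG hpair t ε ht ht1 hε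
  -- name the rescaled forward differences
  obtain ⟨v, hv⟩ : ∃ v : ℕ → Fin 3 → EuclideanSpace ℝ (Fin 3) → EuclideanSpace ℝ (Fin 4),
      ∀ k μ x, v k μ x = (R (φ k) : ℝ) • (u (φ k) ((z (φ k) + fun i => ⌊(R (φ k) : ℝ) * x i⌋) + unitVec μ)
        - u (φ k) (z (φ k) + fun i => ⌊(R (φ k) : ℝ) * x i⌋)) := ⟨_, fun _ _ _ => rfl⟩
  simp only [← hv] at hpair
  -- positivity of the radii
  have hRpos : ∀ k, (0 : ℝ) < (R (φ k) : ℝ) := fun k => by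
    have h1 := hR (φ k)
    have h2 : (0 : ℝ) ≤ (φ k : ℝ) := Nat.cast_nonneg _
    linarith
  -- the sub-cube
  have hQt : MeasurableSet {x : EuclideanSpace ℝ (Fin 3) | ∀ i : Fin 3, |x i| < t} := (isOpen_absCube t).measurableSet
  have hsub : {x : EuclideanSpace ℝ (Fin 3) | ∀ i : Fin 3, |x i| < t} ⊆ {x : EuclideanSpace ℝ (Fin 3) | ∀ i : Fin 3, |x i| < 1} :=
    fun x hx i => lt_of_lt_of_le (hx i) ht1
  have hrestr : (volume.restrict {x : EuclideanSpace ℝ (Fin 3) | ∀ i : Fin 3, |x i| < 1}).restrict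
        {x : EuclideanSpace ℝ (Fin 3) | ∀ i : Fin 3, |x i| < t}
      = volume.restrict {x : EuclideanSpace ℝ (Fin 3) | ∀ i : Fin 3, |x i| < t} := by
    rw [Measure.restrict_restrict hQt, Set.inter_eq_self_of_subset_left hsub]
  -- `G μ` on `Q_t`
  have hGt : ∀ μ, MemLp (G μ) 2 (volume.restrict {x : EuclideanSpace ℝ (Fin 3) | ∀ i : Fin 3, |x i| < t}) := fun μ =>
    (hG μ).mono_measure (Measure.restrict_mono hsub le_rfl)
  have hGint : ∀ μ, Integrable (fun x => ‖G μ x‖ ^ 2) (volume.restrict {x : EuclideanSpace ℝ (Fin 3) | ∀ i : Fin 3, |x i| < t}) :=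
    fun μ => (memLp_two_iff_integrable_sq_norm (hGt μ).1).1 (hGt μ)
  -- `v k μ` on `Q_t`
  have hvmem : ∀ k μ, MemLp (v k μ) 2 (volume.restrict {x : EuclideanSpace ℝ (Fin 3) | ∀ i : Fin 3, |x i| < t}) := by
    intro k μ
    have h := memLp_blowDown_absCube
      (fun y => (R (φ k) : ℝ) • (u (φ k) ((z (φ k) + y) + unitVec μ) - u (φ k) (z (φ k) + y))) t (hRpos k) 2
    refine h.ae_eq (ae_of_all _ fun x => ?_)
    rw [hv]
  have hvint : ∀ k μ, Integrable (fun x => ‖v k μ x‖ ^ 2) (volume.restrict {x : EuclideanSpace ℝ (Fin 3) | ∀ i : Fin 3, |x i| < t}) :=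
    fun k μ => (memLp_two_iff_integrable_sq_norm (hvmem k μ).1).1 (hvmem k μ)
  -- abbreviations `A μ`, `B k μ`
  obtain ⟨A, hA⟩ : ∃ A : Fin 3 → ℝ, ∀ μ, A μ = ∫ x in {x : EuclideanSpace ℝ (Fin 3) | ∀ i : Fin 3, |x i| < t}, ‖G μ x‖ ^ 2 :=
    ⟨_, fun _ => rfl⟩
  obtain ⟨B, hB⟩ : ∃ B : ℕ → Fin 3 → ℝ, ∀ k μ, B k μ = ∫ x in {x : EuclideanSpace ℝ (Fin 3) | ∀ i : Fin 3, |x i| < t}, ‖v k μ x‖ ^ 2 :=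
    ⟨_, fun _ _ => rfl⟩
  -- the pairing with `ψ := 𝟙_{Q_t} G μ` lives on `Q_t`
  have hId : ∀ (μ : Fin 3) (w : EuclideanSpace ℝ (Fin 3) → EuclideanSpace ℝ (Fin 4)),
      ∫ x in {x : EuclideanSpace ℝ (Fin 3) | ∀ i : Fin 3, |x i| < 1},
          ⟪Set.indicator {x : EuclideanSpace ℝ (Fin 3) | ∀ i : Fin 3, |x i| < t} (G μ) x, w x⟫
        = ∫ x in {x : EuclideanSpace ℝ (Fin 3) | ∀ i : Fin 3, |x i| < t}, ⟪G μ x, w x⟫ := by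
    intro μ w
    have hpt : (fun x => ⟪Set.indicator {x : EuclideanSpace ℝ (Fin 3) | ∀ i : Fin 3, |x i| < t} (G μ) x, w x⟫)
        = Set.indicator {x : EuclideanSpace ℝ (Fin 3) | ∀ i : Fin 3, |x i| < t} (fun x => ⟪G μ x, w x⟫) := by
      funext x
      by_cases hx : x ∈ {x : EuclideanSpace ℝ (Fin 3) | ∀ i : Fin 3, |x i| < t}
      · rw [Set.indicator_of_mem hx, Set.indicator_of_mem hx]
      · rw [Set.indicator_of_notMem hx, Set.indicator_of_notMem hx, inner_zero_left]
    rw [hpt, integral_indicator hQt, hrestr]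
  -- the key eventual inequality, one direction at a time
  have key : ∀ μ : Fin 3, ∀ᶠ k in atTop, A μ ≤ B k μ + ε / 3 := by
    intro μ
    have hψ : MemLp (Set.indicator {x : EuclideanSpace ℝ (Fin 3) | ∀ i : Fin 3, |x i| < t} (G μ)) 2
        (volume.restrict {x : EuclideanSpace ℝ (Fin 3) | ∀ i : Fin 3, |x i| < 1}) := (hG μ).indicator hQt
    have hlim := hpair μ _ hψ
    have e1 : (fun k : ℕ => ∫ x in {x : EuclideanSpace ℝ (Fin 3) | ∀ i : Fin 3, |x i| < 1},
        ⟪Set.indicator {x : EuclideanSpace ℝ (Fin 3) | ∀ i : Fin 3, |x i| < t} (G μ) x, v k μ x⟫)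
        = fun k => ∫ x in {x : EuclideanSpace ℝ (Fin 3) | ∀ i : Fin 3, |x i| < t}, ⟪G μ x, v k μ x⟫ :=
      funext fun k => hId μ (v k μ)
    have e2 : ∫ x in {x : EuclideanSpace ℝ (Fin 3) | ∀ i : Fin 3, |x i| < 1},
        ⟪Set.indicator {x : EuclideanSpace ℝ (Fin 3) | ∀ i : Fin 3, |x i| < t} (G μ) x, G μ x⟫ = A μ := by
      rw [hId μ (G μ), hA]
      exact integral_congr_ae (ae_of_all _ fun x => real_inner_self_eq_norm_sq (G μ x))
    rw [e1, e2] at hlim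
    -- the pointwise bound `⟪G, v⟫ ≤ (‖G‖² + ‖v‖²)∕2`, integrated over `Q_t`
    have hcs : ∀ k, ∫ x in {x : EuclideanSpace ℝ (Fin 3) | ∀ i : Fin 3, |x i| < t}, ⟪G μ x, v k μ x⟫ ≤ (A μ + B k μ) / 2 := by
      intro k
      have hrhs : Integrable (fun x => (‖G μ x‖ ^ 2 + ‖v k μ x‖ ^ 2) / 2)
          (volume.restrict {x : EuclideanSpace ℝ (Fin 3) | ∀ i : Fin 3, |x i| < t}) := ((hGint μ).add (hvint k μ)).div_const 2
      have hptw : ∀ x, ⟪G μ x, v k μ x⟫ ≤ (‖G μ x‖ ^ 2 + ‖v k μ x‖ ^ 2) / 2 := fun x => by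
        have h1 := real_inner_le_norm (G μ x) (v k μ x)
        have h2 := two_mul_le_add_sq ‖G μ x‖ ‖v k μ x‖
        linarith
      have hlhs : Integrable (fun x => ⟪G μ x, v k μ x⟫)
          (volume.restrict {x : EuclideanSpace ℝ (Fin 3) | ∀ i : Fin 3, |x i| < t}) := by
        refine hrhs.mono' ((hGt μ).1.inner (hvmem k μ).1) (ae_of_all _ fun x => ?_)
        rw [Real.norm_eq_abs]
        have h1 := abs_real_inner_le_norm (G μ x) (v k μ x)
        have h2 := two_mul_le_add_sq ‖G μ x‖ ‖v k μ x‖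
        linarith
      calc ∫ x in {x : EuclideanSpace ℝ (Fin 3) | ∀ i : Fin 3, |x i| < t}, ⟪G μ x, v k μ x⟫
          ≤ ∫ x in {x : EuclideanSpace ℝ (Fin 3) | ∀ i : Fin 3, |x i| < t}, (‖G μ x‖ ^ 2 + ‖v k μ x‖ ^ 2) / 2 :=
            integral_mono hlhs hrhs hptw
        _ = (A μ + B k μ) / 2 := by
            rw [integral_div, integral_add (hGint μ) (hvint k μ), hA, hB]
    have hev : ∀ᶠ k in atTop, A μ - ε / 6 < ∫ x in {x : EuclideanSpace ℝ (Fin 3) | ∀ i : Fin 3, |x i| < t}, ⟪G μ x, v k μ x⟫ :=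
      hlim.eventually (lt_mem_nhds (by linarith))
    filter_upwards [hev] with k hk
    have := hcs k
    linarith
  -- all three directions at once
  obtain ⟨k₀, hk₀⟩ := eventually_atTop.1 (eventually_all.2 key)
  refine ⟨k₀, fun k hk => ?_⟩
  have hk' := hk₀ k hk
  -- the cell count, direction by direction
  have hBle : ∀ μ : Fin 3, B k μ ≤ (R (φ k) : ℝ)⁻¹ *
      ∑ y ∈ box (z (φ k)) ⌈t * (R (φ k) : ℝ)⌉, ‖u (φ k) (y + unitVec μ) - u (φ k) y‖ ^ 2 := by
    intro μ
    rw [hB]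
    have h := setIntegral_normSq_diffQuot_le (u (φ k)) (z (φ k)) t (hRpos k) μ
    refine le_of_eq_of_le ?_ h
    refine integral_congr_ae (ae_of_all _ fun x => ?_)
    simp only [hv]
  -- assemble
  rw [integral_finsetSum _ fun μ _ => hGint μ]
  calc ∑ μ : Fin 3, ∫ x in {x : EuclideanSpace ℝ (Fin 3) | ∀ i : Fin 3, |x i| < t}, ‖G μ x‖ ^ 2
      = ∑ μ : Fin 3, A μ := Finset.sum_congr rfl fun μ _ => (hA μ).symm
    _ ≤ ∑ μ : Fin 3, (B k μ + ε / 3) := Finset.sum_le_sum fun μ _ => hk' μ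
    _ = (∑ μ : Fin 3, B k μ) + ε := by
        rw [Finset.sum_add_distrib, Finset.sum_const, Finset.card_univ, Fintype.card_fin, nsmul_eq_mul]
        ring
    _ ≤ (∑ μ : Fin 3, (R (φ k) : ℝ)⁻¹ * ∑ y ∈ box (z (φ k)) ⌈t * (R (φ k) : ℝ)⌉, ‖u (φ k) (y + unitVec μ) - u (φ k) y‖ ^ 2) + ε :=
        add_le_add (Finset.sum_le_sum fun μ _ => hBle μ) le_rfl
    _ = (R (φ k) : ℝ)⁻¹ * (∑ y ∈ box (z (φ k)) ⌈t * (R (φ k) : ℝ)⌉, ∑ μ : Fin 3, ‖(u (φ k)) (y + unitVec μ) - (u (φ k)) y‖ ^ 2) + ε := by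
        rw [← Finset.mul_sum, Finset.sum_comm]

end Summit.QuantumFields.YangMills.Theorems.PoincareLipschitzBlowDownEnergyLscEps

end
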